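import Summits.RiemannHypothesis.RiemannHypothesis.Theorems.HandoffDecomposition
import HarnessLib

/-!
# THETA tier-1 — decidable `ConsecutivePrimes` for the data rows (trial division; cc-s2-1, WEIL typing lane; RH-FREE)

The per-row closers of items 19173/19186 need `Handoff.ConsecutivePrimes r.q r.qn` (hence `nextPrime r.q = r.qn`,
`HandoffDecomposition.nextPrime_eq_of_consecutivePrimes`) for ≈ 5 200 rows with `q < 6·10⁴`.  This file gives a structurally
recursive trial-division check that `decide +kernel` evaluates in milliseconds per row, with its soundness:

* `noDvd n k fuel` (no `d ∈ [k, k+fuel)` divides `n`), `primeCheck n`, `compositeCheck n`, `consecCheck q qn`;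
* `primeCheck_sound : primeCheck n = true → n.Prime`, `compositeCheck_sound : compositeCheck n = true → ¬ n.Prime`,
  **`consecCheck_sound : consecCheck q qn = true → Handoff.ConsecutivePrimes q qn`**, `nextPrime_eq_of_consecCheck`.

Nothing here bears on the truth of RH.
-/

set_option linter.dupNamespace false  -- the mandated namespace repeats `RiemannHypothesis`
set_option autoImplicit false

namespace Summit.RiemannHypothesis.RiemannHypothesis.Theorems.ThetaTier1

/-- `noDvd n k fuel = true` iff no `d` with `k ≤ d < k + fuel` divides `n` (trial division). [folklore] -/
def noDvd (n : ℕ) : ℕ → ℕ → Bool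
  | _, 0 => true
  | k, fuel + 1 => !(n % k == 0) && noDvd n (k + 1) fuel

/-- Soundness of `noDvd`. [folklore] -/
theorem noDvd_sound (n : ℕ) : ∀ (k fuel : ℕ), noDvd n k fuel = true → ∀ d, k ≤ d → d < k + fuel → ¬ d ∣ n
  | k, 0, _, d, h1, h2 => by omega
  | k, fuel + 1, h, d, h1, h2 => by
      simp only [noDvd, Bool.and_eq_true, Bool.not_eq_true', beq_eq_false_iff_ne, ne_eq] at h
      rcases Nat.eq_or_lt_of_le h1 with rfl | hlt
      · intro hd
        exact h.1 (Nat.mod_eq_zero_of_dvd hd)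
      · exact noDvd_sound n (k + 1) fuel h.2 d hlt (by omega)

/-- Trial-division primality check: `2 ≤ n` and no divisor in `[2, √n]`. [folklore] -/
def primeCheck (n : ℕ) : Bool := decide (2 ≤ n) && noDvd n 2 (Nat.sqrt n - 1)

/-- **Soundness**: `primeCheck n = true → n.Prime` (`Nat.prime_def_le_sqrt`). [folklore] -/
theorem primeCheck_sound {n : ℕ} (h : primeCheck n = true) : n.Prime := by
  simp only [primeCheck, Bool.and_eq_true, decide_eq_true_eq] at h
  rw [Nat.prime_def_le_sqrt]
  refine ⟨h.1, fun m hm2 hms => noDvd_sound n 2 (Nat.sqrt n - 1) h.2 m hm2 (by omega)⟩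

/-- Compositeness check: some `d ∈ [2, √n]` divides `n` (or `n < 2`). [folklore] -/
def compositeCheck (n : ℕ) : Bool := decide (n < 2) || !noDvd n 2 (Nat.sqrt n - 1)

/-- A witness of `noDvd n k fuel = false`: some `d ∈ [k, k + fuel)` divides `n`. [folklore] -/
theorem exists_dvd_of_noDvd_false (n : ℕ) : ∀ (k fuel : ℕ), noDvd n k fuel = false → ∃ d, k ≤ d ∧ d < k + fuel ∧ d ∣ n
  | k, 0, h => by simp [noDvd] at h
  | k, fuel + 1, h => by
      simp only [noDvd, Bool.and_eq_false_iff, Bool.not_eq_false', beq_iff_eq] at h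
      rcases h with h | h
      · exact ⟨k, le_rfl, by omega, Nat.dvd_of_mod_eq_zero h⟩
      · obtain ⟨d, h1, h2, h3⟩ := exists_dvd_of_noDvd_false n (k + 1) fuel h
        exact ⟨d, by omega, by omega, h3⟩

/-- **Soundness**: `compositeCheck n = true → ¬ n.Prime`. [folklore] -/
theorem compositeCheck_sound {n : ℕ} (h : compositeCheck n = true) : ¬ n.Prime := by
  simp only [compositeCheck, Bool.or_eq_true, decide_eq_true_eq, Bool.not_eq_true'] at h
  intro hp
  rcases h with h | h
  · exact absurd hp.two_le (by omega)
  · obtain ⟨d, h1, h2, h3⟩ := exists_dvd_of_noDvd_false n 2 _ h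
    have hds : d ≤ Nat.sqrt n := by omega
    have hdn : d < n := lt_of_le_of_lt hds (Nat.sqrt_lt_self hp.one_lt)
    rcases (Nat.dvd_prime hp).1 h3 with rfl | rfl
    · omega
    · exact absurd hdn (lt_irrefl _)

/-- Every `n ∈ [k, k + fuel)` is composite. [folklore] -/
def allComposite : ℕ → ℕ → Bool
  | _, 0 => true
  | k, fuel + 1 => compositeCheck k && allComposite (k + 1) fuel

/-- Soundness of `allComposite`. [folklore] -/
theorem allComposite_sound : ∀ (k fuel : ℕ), allComposite k fuel = true → ∀ n, k ≤ n → n < k + fuel → ¬ n.Prime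
  | k, 0, _, n, h1, h2 => by omega
  | k, fuel + 1, h, n, h1, h2 => by
      simp only [allComposite, Bool.and_eq_true] at h
      rcases Nat.eq_or_lt_of_le h1 with rfl | hlt
      · exact compositeCheck_sound h.1
      · exact allComposite_sound (k + 1) fuel h.2 n hlt (by omega)

/-- **The consecutive-primes check of a row**: `q`, `qn` prime, `q < qn`, nothing prime strictly between. [this cell] -/
def consecCheck (q qn : ℕ) : Bool :=
  primeCheck q && primeCheck qn && decide (q < qn) && allComposite (q + 1) (qn - q - 1)

/-- **Soundness**: `consecCheck q qn = true → ConsecutivePrimes q qn` (in the sense of `HandoffWindow.lean`). [this cell] -/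
theorem consecCheck_sound {q qn : ℕ} (h : consecCheck q qn = true) : Handoff.ConsecutivePrimes q qn := by
  simp only [consecCheck, Bool.and_eq_true, decide_eq_true_eq] at h
  obtain ⟨⟨⟨hq, hqn⟩, hlt⟩, hall⟩ := h
  refine ⟨primeCheck_sound hq, primeCheck_sound hqn, hlt, fun p hp hqp => ?_⟩
  by_contra hlt'
  exact allComposite_sound (q + 1) (qn - q - 1) hall p (by omega) (by omega) hp

/-- Hence `nextPrime q = qn` for a checked row. [this cell] -/
theorem nextPrime_eq_of_consecCheck {q qn : ℕ} (h : consecCheck q qn = true) : HandoffDecomposition.nextPrime q = qn :=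
  HandoffDecomposition.nextPrime_eq_of_consecutivePrimes (consecCheck_sound h)

/-- Kernel smoke test: `59743 < 59747` are consecutive primes. -/
example : consecCheck 59743 59747 = true := by decide +kernel

end Summit.RiemannHypothesis.RiemannHypothesis.Theorems.ThetaTier1
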